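import Mathlib

/-!
# Towards removing (Dickson): a dense piece of `φ(SL₂ k)` inside the approximate group
# (crux `LevelGradedCohnUmans.GradedDesignFamily`, stmt-MatrixMultiplication-7610; negative side,
# line `quadratic-extension-level-one-cell`, unit b2b-lgcu-subfield gen 18)

HONEST FRAMING.  After gen 18, `¬ stub_subfieldCell ⇐ (BGT) ∧ (Dickson)`.  Route (D′) of the cell doc
(SUBFIELD.md §23.6) proposes to shrink (Dickson) to an overgroup statement for `SL₂(q) ≤ SL₂(q²)` by
observing that the approximate group `𝓗` produced by Tao's theorem from the cover `φ(H)·Y ⊆ X·𝓗`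
contains, up to conjugation, a `(1/|X|)`-dense symmetric piece of the genuine subgroup `φ(H)`.  This
file lands that first, purely combinatorial step:

* `densePiece_of_subset_mul` — if `S·Y ⊆ X·H` (`S`, `Y` non-empty) then for some `x ∈ X`, `y ∈ Y` the
  piece `P = {s ∈ S : x⁻¹ s y ∈ H}` has `|S| ≤ |X|·|P|`, and `x⁻¹·(P·P⁻¹)·x ⊆ H·H⁻¹`.

Support lemma only; NOT summit progress.  Sorry-free. [folklore]
-/

set_option linter.dupNamespace false

open scoped Pointwise

namespace Summit.MatrixMultiplication.MatrixMultiplication.Theorems.GradedDesignFamily.Negative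

/-- **Dense piece.**  If `S·Y ⊆ X·H` with `S`, `Y` non-empty, then some `x ∈ X`, `y ∈ Y` give a piece
`P = {s ∈ S : x⁻¹·s·y ∈ H}` with `|S| ≤ |X|·|P|` whose difference set conjugates into `H·H⁻¹`:
`x⁻¹ (s s'⁻¹) x ∈ H·H⁻¹` for `s, s' ∈ P`. [folklore] -/
theorem densePiece_of_subset_mul {G : Type} [Group G] [DecidableEq G] (S Y X H : Finset G)
    (hS : S.Nonempty) (hY : Y.Nonempty) (hcov : S * Y ⊆ X * H) :
    ∃ x ∈ X, ∃ y ∈ Y,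
      S.card ≤ X.card * (S.filter (fun s => x⁻¹ * s * y ∈ H)).card ∧
      ∀ s ∈ S.filter (fun s => x⁻¹ * s * y ∈ H), ∀ s' ∈ S.filter (fun s => x⁻¹ * s * y ∈ H),
        x⁻¹ * (s * s'⁻¹) * x ∈ H * H⁻¹ := by
  obtain ⟨y, hy⟩ := hY
  have key : ∀ s ∈ S, ∃ x ∈ X, x⁻¹ * s * y ∈ H := by
    intro s hs
    have hsy : s * y ∈ X * H := hcov (Finset.mul_mem_mul hs hy)
    obtain ⟨x, hx, h, hh, hxh⟩ := Finset.mem_mul.mp hsy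
    refine ⟨x, hx, ?_⟩
    rw [mul_assoc, ← hxh, inv_mul_cancel_left]
    exact hh
  have hsub : S ⊆ X.biUnion (fun x => S.filter (fun s => x⁻¹ * s * y ∈ H)) := by
    intro s hs
    rw [Finset.mem_biUnion]
    obtain ⟨x, hx, h⟩ := key s hs
    exact ⟨x, hx, Finset.mem_filter.mpr ⟨hs, h⟩⟩
  have hsum : S.card ≤ ∑ x ∈ X, (S.filter (fun s => x⁻¹ * s * y ∈ H)).card :=
    (Finset.card_le_card hsub).trans Finset.card_biUnion_le
  have hXne : X.Nonempty := by
    obtain ⟨s, hs⟩ := hS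
    obtain ⟨x, hx, -⟩ := key s hs
    exact ⟨x, hx⟩
  obtain ⟨x, hx, hle⟩ := Finset.exists_le_of_sum_le hXne (f := fun _ => S.card)
    (g := fun x => X.card * (S.filter (fun s => x⁻¹ * s * y ∈ H)).card) (by
      rw [Finset.sum_const, smul_eq_mul, ← Finset.mul_sum]
      exact Nat.mul_le_mul_left _ hsum)
  refine ⟨x, hx, y, hy, hle, ?_⟩
  intro s hs s' hs'
  rw [Finset.mem_filter] at hs hs'
  have e : x⁻¹ * (s * s'⁻¹) * x = (x⁻¹ * s * y) * (x⁻¹ * s' * y)⁻¹ := by group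
  rw [e]
  exact Finset.mul_mem_mul hs.2 (Finset.inv_mem_inv hs'.2)

end Summit.MatrixMultiplication.MatrixMultiplication.Theorems.GradedDesignFamily.Negative
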